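import Literature.Analysis.FluidPDE.FlatSwirlGaugeChart
import HarnessLib

/-!
# The exactly-flat anchor of the flat swirl gauge in distribution-function form

Companion to `Literature/Analysis/FluidPDE/FlatSwirlGauge.lean` (the object `IsFlatSwirlGaugeOn` /
`HasFlatSwirlGauge` POSITED by route `FlatSwirlGauge` of `NavierStokesRegularity`; not a published notion)
and `FlatSwirlGaugeChart.lean` (`ratioDepth`, `isVortexChartOn_ratioDepth`). The tree's anchor
`IsClassicalNSSolutionOn.isFlatSwirlGaugeOn_swirl` realises the gauge with momentum `Γ = r u_θ`
(KNSS 2009, (1.8)) and depth `d = r` under the POINTWISE hypothesis `‖curl u‖ r ≤ C₀ ‖∇Γ‖` on the whole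
cylinder. That hypothesis fails as soon as `Γ(t,·)` has a critical circle inside the ball (there
`∇Γ = 0`, `r > 0` and generically `curl u ≠ 0`), which happens for every swirling flow with `Γ = 0` on
the axis and at infinity. This file proves the anchor under the hypothesis the typed gauge actually
needs — the single DISTRIBUTION-FUNCTION bound
`vol({C₀ ‖∇Γ‖ < δ ‖curl u‖} ∩ B_ρ(x₀)) ≤ C₀ δ² ρ` (`0 < δ < ρ`) — with the depth
`d = min r (ratioDepth C₀ ρ u Γ)`, and shows that this bound is also NECESSARY for any gauge whose
momentum is `Γ`:

* `IsClassicalNSSolutionOn.isFlatSwirlGaugeOn_swirl_of_volume_ratio` — axisymmetric classical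
  solution, `|Γ| ≤ M` on `Q_ρ(T, x₀)`, the distribution-function bound with constant `C₀ ≥ 0` ⟹
  `(Γ, −(2/r) e_r, min r ratioDepth, C₀ + 8, M)` is a flat swirl gauge (volume: axis tube `8δ²ρ` plus
  the ratio set `C₀δ²ρ`; chart clause from `ratioDepth`; drift clause `‖b‖ d ≤ (2/r) r = 2`; transport
  law = KNSS (1.8) off the axis, where `d > 0` forces `r > 0`);
* `IsClassicalNSSolutionOn.hasFlatSwirlGauge_of_axisymmetric_volume_ratio` — hence `HasFlatSwirlGauge`;
* `volume_ratio_lt_le_of_isFlatSwirlGaugeOn_swirl` — conversely every gauge with momentum `Γ` and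
  constant `C₀` satisfies the bound with the same `C₀` (`IsVortexChartOn.volume_ratio_lt_le`);
* `IsClassicalNSSolutionOn.exists_isFlatSwirlGaugeOn_swirl_iff` — so, for axisymmetric classical
  solutions, "some flat swirl gauge on `Q_ρ(T, x₀)` has momentum `Γ`" is EQUIVALENT to "`Γ` is bounded
  on the cylinder and the distribution-function bound holds for some `C₀ ≥ 0`".

The quantity `|∇Γ| / |curl u| = r |ω_p| / |ω|` (`ω_p` the poloidal vorticity) is the one the route's
kill criterion K2 evaluates on T. Y. Hou's potentially singular axisymmetric profile
(arXiv:2107.06509); the last theorem is the exact typed meaning of that test in the exactly-flat class.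

## References

* G. Koch, N. Nadirashvili, G. Seregin, V. Šverák, *Liouville theorems for the Navier–Stokes equations
  and applications*, Acta Math. 203 (2009) 83–105, eq. (1.8). [KNSS2009]
* T. Y. Hou, *The potentially singular behavior of the 3D Navier–Stokes equations*, Found. Comput.
  Math. (2022), arXiv:2107.06509, §2. [Hou2022PotentiallySingularNS]
-/

noncomputable section

open MeasureTheory Set Function Filter Metric InnerProductSpace WithLp
open scoped RealInnerProductSpace ENNReal Laplacian

namespace Literature.Analysis.FluidPDE

/-- `‖e_r‖ ≤ 1` (it is `1` off the axis and `0` on it). [folklore] -/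
private theorem norm_eR_le_one_aux (x : (EuclideanSpace ℝ (Fin 3))) : ‖eR x‖ ≤ 1 := by
  have hr : 0 ≤ cylRadius x := cylRadius_nonneg x
  have hn : ‖(toLp 2 ![x 0, x 1, 0] : (EuclideanSpace ℝ (Fin 3)))‖ = cylRadius x := by
    rw [EuclideanSpace.norm_eq, cylRadius]
    congr 1
    simp [Fin.sum_univ_three]
  by_cases hx : cylRadius x = 0
  · rw [eR, norm_smul, hn, hx, mul_zero]
    exact zero_le_one
  · rw [eR, norm_smul, norm_inv, Real.norm_eq_abs, abs_of_nonneg hr, hn, inv_mul_cancel₀ hx]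

/-- The KNSS drift `b = −(2/r) e_r` times any depth `d ≤ r` is at most `2`: `‖b‖ d ≤ (2/r) r = 2`
(`0 < r`). [folklore] -/
theorem norm_knssDrift_mul_le_two {x : (EuclideanSpace ℝ (Fin 3))} {d : ℝ} (hr : 0 < cylRadius x)
    (hd0 : 0 ≤ d) (hd : d ≤ cylRadius x) : ‖(-(2 / cylRadius x)) • eR x‖ * d ≤ 2 := by
  rw [norm_smul, norm_neg, norm_div, Real.norm_eq_abs, Real.norm_eq_abs, abs_of_pos hr, abs_two]
  calc 2 / cylRadius x * ‖eR x‖ * d ≤ 2 / cylRadius x * 1 * cylRadius x := by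
        gcongr
        exact norm_eR_le_one_aux x
    _ = 2 := by field_simp

/-- **The exactly-flat anchor in distribution-function form.** For a classical Navier–Stokes solution
on `ℝ³ × [0, T)` (any `ν`, no force) with axisymmetric velocity and pressure, a backward cylinder
`Q_ρ(T, x₀)` (`0 < ρ`, `ρ² < T`) on which `|Γ| ≤ M`, and a constant `C₀ ≥ 0` with
`vol({C₀ ‖∇Γ(t,·)‖ < δ ‖curl u(t,·)‖} ∩ B_ρ(x₀)) ≤ C₀ δ² ρ` for all `t ∈ (T − ρ², T)`, `δ ∈ (0, ρ)`, the
data `α = Γ = swirl u`, `b = −(2/r) e_r`, `d = min r (ratioDepth C₀ ρ u Γ)` form a flat swirl gauge with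
constants `C₀ + 8`, `M`: the volume clause is the axis tube (`volume_cylRadius_lt_inter_ball_le`,
`8δ²ρ`) plus the ratio set (`isVortexChartOn_ratioDepth`, `C₀δ²ρ`); where `d > 0` one has `r > 0` and
`ratioDepth > 0`, so `‖ω‖ d ≤ ‖ω‖ ratioDepth ≤ C₀‖∇Γ‖`, `‖b‖ d ≤ (2/r) r = 2`, and the flat transport law
is KNSS 2009 (1.8) off the axis (`IsClassicalNSSolutionOn.deriv_swirl_transport`). No pointwise bound
on `‖curl u‖ r / ‖∇Γ‖` is assumed (compare `isFlatSwirlGaugeOn_swirl`). [cite: KNSS2009, eq. (1.8)] -/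
theorem IsClassicalNSSolutionOn.isFlatSwirlGaugeOn_swirl_of_volume_ratio {ν T : ℝ}
    {u : ℝ → (EuclideanSpace ℝ (Fin 3)) → (EuclideanSpace ℝ (Fin 3))} {p : ℝ → (EuclideanSpace ℝ (Fin 3)) → ℝ}
    (h : IsClassicalNSSolutionOn (Ico 0 T) ν 0 u p)
    (hu : ∀ t ∈ Ico 0 T, IsAxisymmetric (u t)) (hp : ∀ t ∈ Ico 0 T, IsAxisymmetricScalar (p t))
    {x₀ : (EuclideanSpace ℝ (Fin 3))} {ρ C₀ M : ℝ} (hρ : 0 < ρ) (hρT : ρ ^ 2 < T)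
    (hC₀ : 0 ≤ C₀)
    (hM : ∀ t ∈ Ioo (T - ρ ^ 2) T, ∀ x ∈ ball x₀ ρ, |swirl (u t) x| ≤ M)
    (hvol : ∀ t ∈ Ioo (T - ρ ^ 2) T, ∀ δ ∈ Ioo 0 ρ,
      volume ({x | C₀ * ‖gradient (swirl (u t)) x‖ < δ * ‖curl (u t) x‖} ∩ ball x₀ ρ) ≤
        ENNReal.ofReal (C₀ * δ ^ 2 * ρ)) :
    IsFlatSwirlGaugeOn ν u T x₀ ρ (C₀ + 8) M (fun t => swirl (u t))
      (fun _ x => (-(2 / cylRadius x)) • eR x)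
      (fun t x => min (cylRadius x) (ratioDepth C₀ ρ u (fun s => swirl (u s)) t x)) := by
  have hI : Ioo (T - ρ ^ 2) T ⊆ Ioo 0 T := Ioo_subset_Ioo_left (by linarith)
  have hcd : ContDiffOn ℝ 2 (uncurry fun t x => swirl (u t) x) (Ioo (T - ρ ^ 2) T ×ˢ ball x₀ ρ) :=
    h.smooth_velocity.contDiffOn_uncurry_swirl.mono
      (prod_mono (hI.trans Ioo_subset_Ico_self) (subset_univ _))
  have hfirst : ∀ t ∈ Ioo (T - ρ ^ 2) T, ∀ x ∈ ball x₀ ρ,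
      ⟪curl (u t) x, gradient (swirl (u t)) x⟫ = 0 :=
    fun t ht x _ => (hu t (Ioo_subset_Ico_self (hI ht))).inner_curl_gradient_swirl x
  -- the chart with depth `ratioDepth` from the distribution-function bound
  have hchart : IsVortexChartOn u T x₀ ρ C₀ M (fun t => swirl (u t))
      (ratioDepth C₀ ρ u fun s => swirl (u s)) :=
    isVortexChartOn_ratioDepth hρ hρT hcd hM hfirst hC₀ hvol
  refine ⟨hρ, hρT, hcd, fun t ht δ hδ => ?_, fun t ht x hx => ?_⟩
  · -- volume: `{min r ratioDepth < δ} ⊆ {r < δ} ∪ {ratioDepth < δ}`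
    have hsub : {x : (EuclideanSpace ℝ (Fin 3)) |
          min (cylRadius x) (ratioDepth C₀ ρ u (fun s => swirl (u s)) t x) < δ} ∩ ball x₀ ρ ⊆
        ({x : (EuclideanSpace ℝ (Fin 3)) | cylRadius x < δ} ∩ ball x₀ ρ) ∪
          ({x : (EuclideanSpace ℝ (Fin 3)) |
            ratioDepth C₀ ρ u (fun s => swirl (u s)) t x < δ} ∩ ball x₀ ρ) := by
      rintro x ⟨hx, hxB⟩
      rw [mem_setOf_eq] at hx
      rcases min_lt_iff.1 hx with h1 | h1
      · exact Or.inl ⟨h1, hxB⟩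
      · exact Or.inr ⟨h1, hxB⟩
    have h8 : 0 ≤ 8 * δ ^ 2 * ρ := by positivity
    have hC : 0 ≤ C₀ * δ ^ 2 * ρ := by positivity
    calc volume ({x : (EuclideanSpace ℝ (Fin 3)) |
            min (cylRadius x) (ratioDepth C₀ ρ u (fun s => swirl (u s)) t x) < δ} ∩ ball x₀ ρ)
        ≤ volume ({x : (EuclideanSpace ℝ (Fin 3)) | cylRadius x < δ} ∩ ball x₀ ρ) +
            volume ({x : (EuclideanSpace ℝ (Fin 3)) |
              ratioDepth C₀ ρ u (fun s => swirl (u s)) t x < δ} ∩ ball x₀ ρ) :=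
          (measure_mono hsub).trans (measure_union_le _ _)
      _ ≤ ENNReal.ofReal (8 * δ ^ 2 * ρ) + ENNReal.ofReal (C₀ * δ ^ 2 * ρ) :=
          add_le_add (volume_cylRadius_lt_inter_ball_le x₀ ρ hδ.1.le) (hchart.2.2.2.1 t ht δ hδ)
      _ = ENNReal.ofReal ((C₀ + 8) * δ ^ 2 * ρ) := by
          rw [← ENNReal.ofReal_add h8 hC]
          congr 1
          ring
  · refine ⟨hM t ht x hx, hfirst t ht x hx, fun hd => ?_⟩
    have hr : 0 < cylRadius x := hd.trans_le (min_le_left _ _)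
    have hrd : 0 < ratioDepth C₀ ρ u (fun s => swirl (u s)) t x := hd.trans_le (min_le_right _ _)
    refine ⟨?_, ?_, h.deriv_swirl_transport hu hp (hI ht) hr.ne'⟩
    · -- chart nondegeneracy: `‖ω‖ min r ratioDepth ≤ ‖ω‖ ratioDepth ≤ C₀ ‖∇Γ‖ ≤ (C₀ + 8) ‖∇Γ‖`
      calc ‖curl (u t) x‖ * min (cylRadius x) (ratioDepth C₀ ρ u (fun s => swirl (u s)) t x)
          ≤ ‖curl (u t) x‖ * ratioDepth C₀ ρ u (fun s => swirl (u s)) t x :=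
            mul_le_mul_of_nonneg_left (min_le_right _ _) (norm_nonneg _)
        _ ≤ C₀ * ‖gradient (swirl (u t)) x‖ := (hchart.2.2.2.2 t ht x hx).2.2 hrd
        _ ≤ (C₀ + 8) * ‖gradient (swirl (u t)) x‖ := by
            have := norm_nonneg (gradient (swirl (u t)) x)
            nlinarith
    · -- drift clause: `‖b‖ d ≤ (2/r) r = 2 ≤ C₀ + 8`
      exact (norm_knssDrift_mul_le_two hr hd.le (min_le_left _ _)).trans (by linarith)

/-- **Axisymmetric flows have flat swirl gauges wherever `Γ` is bounded and the distribution-function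
bound `vol({C₀‖∇Γ‖ < δ‖curl u‖} ∩ B_ρ(x₀)) ≤ C₀δ²ρ` holds** (corollary of
`isFlatSwirlGaugeOn_swirl_of_volume_ratio`). [cite: KNSS2009, eq. (1.8)] -/
theorem IsClassicalNSSolutionOn.hasFlatSwirlGauge_of_axisymmetric_volume_ratio {ν T : ℝ}
    {u : ℝ → (EuclideanSpace ℝ (Fin 3)) → (EuclideanSpace ℝ (Fin 3))} {p : ℝ → (EuclideanSpace ℝ (Fin 3)) → ℝ}
    (h : IsClassicalNSSolutionOn (Ico 0 T) ν 0 u p)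
    (hu : ∀ t ∈ Ico 0 T, IsAxisymmetric (u t)) (hp : ∀ t ∈ Ico 0 T, IsAxisymmetricScalar (p t))
    {x₀ : (EuclideanSpace ℝ (Fin 3))} {ρ C₀ M : ℝ} (hρ : 0 < ρ) (hρT : ρ ^ 2 < T)
    (hC₀ : 0 ≤ C₀)
    (hM : ∀ t ∈ Ioo (T - ρ ^ 2) T, ∀ x ∈ ball x₀ ρ, |swirl (u t) x| ≤ M)
    (hvol : ∀ t ∈ Ioo (T - ρ ^ 2) T, ∀ δ ∈ Ioo 0 ρ,
      volume ({x | C₀ * ‖gradient (swirl (u t)) x‖ < δ * ‖curl (u t) x‖} ∩ ball x₀ ρ) ≤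
        ENNReal.ofReal (C₀ * δ ^ 2 * ρ)) :
    HasFlatSwirlGauge ν u T x₀ :=
  (h.isFlatSwirlGaugeOn_swirl_of_volume_ratio hu hp hρ hρT hC₀ hM hvol).hasFlatSwirlGauge

/-- **The distribution-function bound is necessary.** Any flat swirl gauge on `Q_ρ(T, x₀)` whose
momentum is the swirl `Γ` (any drift `b`, any depth `d`, constant `C₀`) satisfies
`vol({C₀‖∇Γ‖ < δ‖curl u‖} ∩ B_ρ(x₀)) ≤ C₀δ²ρ` for all admissible `t` and `δ ∈ (0, ρ)`
(`IsVortexChartOn.volume_ratio_lt_le` applied to the chart underlying the gauge). [folklore] -/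
theorem volume_ratio_lt_le_of_isFlatSwirlGaugeOn_swirl {ν T ρ C₀ M : ℝ}
    {u : ℝ → (EuclideanSpace ℝ (Fin 3)) → (EuclideanSpace ℝ (Fin 3))} {x₀ : (EuclideanSpace ℝ (Fin 3))}
    {b : ℝ → (EuclideanSpace ℝ (Fin 3)) → (EuclideanSpace ℝ (Fin 3))} {d : ℝ → (EuclideanSpace ℝ (Fin 3)) → ℝ}
    (hg : IsFlatSwirlGaugeOn ν u T x₀ ρ C₀ M (fun t => swirl (u t)) b d) {t : ℝ}
    (ht : t ∈ Ioo (T - ρ ^ 2) T) {δ : ℝ} (hδ : δ ∈ Ioo 0 ρ) :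
    volume ({x | C₀ * ‖gradient (swirl (u t)) x‖ < δ * ‖curl (u t) x‖} ∩ ball x₀ ρ) ≤
      ENNReal.ofReal (C₀ * δ ^ 2 * ρ) :=
  (isVortexChartOn_of_gauge hg).volume_ratio_lt_le ht hδ

/-- **The exactly-flat class, typed exactly.** For a classical Navier–Stokes solution on `ℝ³ × [0, T)`
with axisymmetric velocity and pressure and a cylinder `Q_ρ(T, x₀)` (`0 < ρ`, `ρ² < T`): SOME flat swirl
gauge on `Q_ρ(T, x₀)` has momentum `Γ = swirl u` **iff** `Γ` is bounded on the cylinder and, for some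
`C₀ ≥ 0`, `vol({C₀‖∇Γ(t,·)‖ < δ‖curl u(t,·)‖} ∩ B_ρ(x₀)) ≤ C₀δ²ρ` for all `t ∈ (T − ρ², T)`,
`δ ∈ (0, ρ)`. Forward: `IsFlatSwirlGaugeOn.const_nonneg`, `.abs_le` and
`volume_ratio_lt_le_of_isFlatSwirlGaugeOn_swirl`; backward: `isFlatSwirlGaugeOn_swirl_of_volume_ratio`
(constant `C₀ + 8`). This is the typed content of the route's kill criterion K2
(`|∇Γ|/|curl u| = r|ω_p|/|ω|`) in the exactly-flat class. [cite: KNSS2009, eq. (1.8)] -/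
theorem IsClassicalNSSolutionOn.exists_isFlatSwirlGaugeOn_swirl_iff {ν T : ℝ}
    {u : ℝ → (EuclideanSpace ℝ (Fin 3)) → (EuclideanSpace ℝ (Fin 3))} {p : ℝ → (EuclideanSpace ℝ (Fin 3)) → ℝ}
    (h : IsClassicalNSSolutionOn (Ico 0 T) ν 0 u p)
    (hu : ∀ t ∈ Ico 0 T, IsAxisymmetric (u t)) (hp : ∀ t ∈ Ico 0 T, IsAxisymmetricScalar (p t))
    {x₀ : (EuclideanSpace ℝ (Fin 3))} {ρ : ℝ} (hρ : 0 < ρ) (hρT : ρ ^ 2 < T) :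
    (∃ (C₀ M : ℝ) (b : ℝ → (EuclideanSpace ℝ (Fin 3)) → (EuclideanSpace ℝ (Fin 3)))
        (d : ℝ → (EuclideanSpace ℝ (Fin 3)) → ℝ),
        IsFlatSwirlGaugeOn ν u T x₀ ρ C₀ M (fun t => swirl (u t)) b d) ↔
      ∃ C₀ M : ℝ, 0 ≤ C₀ ∧ (∀ t ∈ Ioo (T - ρ ^ 2) T, ∀ x ∈ ball x₀ ρ, |swirl (u t) x| ≤ M) ∧
        ∀ t ∈ Ioo (T - ρ ^ 2) T, ∀ δ ∈ Ioo 0 ρ,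
          volume ({x | C₀ * ‖gradient (swirl (u t)) x‖ < δ * ‖curl (u t) x‖} ∩ ball x₀ ρ) ≤
            ENNReal.ofReal (C₀ * δ ^ 2 * ρ) := by
  constructor
  · rintro ⟨C₀, M, b, d, hg⟩
    exact ⟨C₀, M, hg.const_nonneg, fun t ht x hx => hg.abs_le ht hx,
      fun t ht δ hδ => volume_ratio_lt_le_of_isFlatSwirlGaugeOn_swirl hg ht hδ⟩
  · rintro ⟨C₀, M, hC₀, hM, hvol⟩
    exact ⟨C₀ + 8, M, _, _, h.isFlatSwirlGaugeOn_swirl_of_volume_ratio hu hp hρ hρT hC₀ hM hvol⟩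

end Literature.Analysis.FluidPDE

end
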